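import Summits.QuantumFields.YangMills.Theorems.BalabanUVNodesN08SeriesACStepBounds

/-!
# BalabanUVNodes ∕ N08 — THE RE-MASSED AC TOWER, I-b: the step leaves C1 `Bound55` ∕ C2 `Bound55Lower` of [Balaban1985UV3] FOR THE RE-MASSED BASE
# `{ X.toTowerBase 𝔠.lane.carrier with W := W′ }` from the (α)-AC step input and a mass carrier `W′` agreeing `dU`-a.e. with print's `massRecAC`

Track A, DAG node N08 = T. Bałaban, CMP **102** (1985) 255–275 [Balaban1985UV3]: (41) p. 266, (48)–(49) pp. 267–268, (55) p. 269, (58) p. 270, p. 272 L32–33; the averaging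
(2) = [Balaban1985Averaging] (15) p. 19.  Cell `pub-ymgap`, width seat `pub-ymgap-dag-n08-w1` (g4), W-SEAT-START-LIST §n08 item 1 successor piece (o13b) = file 19b;
`--supports` K1⁷ `StabilityBAtRecordR13SepCoPH` (helper).  Companion of I-a `…N08SeriesACStepBounds` (normal forms + the generic step) and of files 15∕16∕17∕18.

THE POINT (located, count-neutral).  The gap between file 15 (pointwise `hmass` ⇒ the slot) and files 16∕17 (a.e. mass bound ⟸ density bound on `ν♯`) is a VERSION
gap.  The cure is a RE-SELECTION of the masses on null sets: a series AC tower over the SAME external inputs `X`, the SAME expansion data `𝔖`, the SAME parameters, with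
the mass carrier `W′` replaced; its barriers, hence its R-RN-selected densities, follow `W′` by construction (`SeriesAC.TowerBaseAC.withSeriesAC`).  Every leaf of the
(α) → Theorem 2 chain that does not read the masses is the lane's at the re-massed base by I-a's normal forms; the two that do — C1 (transport step: `hm₁`, `hcover`, the
fibre display R3D-01) and C2 (the floor at the trivial history) — are derived HERE from `W′ =ᵐ massRecAC` levelwise (`hae`), `W′ ≤ massRecAC` pointwise (`hle`),
measurability (`hWm`), `1 ≤ W′(triv)` (`hmt`).  The capped masses `min (massRecAC) (e^{c_k})` of files 15∕18 satisfy all four under the a.e. bound of files 16∕17.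

WHAT THIS FILE PROVES (kernel; theorems only, 0 def; nothing of the paper asserted).
* `transport_weighted_le_ae_congr`, `fibre_le_ae_congr` — abstract a.e. transfers (`Carriers.rnTransport_congr_ae`: the transport sees only the `dU`-class).
* `reMassed_mass_eq_zero_of_not_admissible`, ★ `transport_le_reMassed_ae` (`hm₁` for `W′`, `k + 1 ≤ K`, from `MassesAC.transport_le_massRecAC_ae`), `integrable_reMassed`.
* ★ `fibre57Low_reMassed`, ★★ `fibre49_reMassed` — R3D-02∕R3D-01 for the re-massed base FROM `StepAlphaAC.fibre57Low∕fibre49` (normal forms of I-a on both sides; mass swap).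
* ★★★ `bound55_reMassed`, ★★★ `bound55Lower_reMassed` — **C1∕C2 at the pinned pieces of `{ X.toTowerBase 𝔠.lane.carrier with W := W′ }` from `StepAlphaAC 𝔊 𝔠 X 𝔖 𝔄 k`
  + `hae` + `hle` + `hWm` + `hmt`** (thresholds `ε_L ≤ ε_S` by `AlphaBound55.eps1Of_le_epsSOf`; rows `hU`∕`hPm`∕`hPb` read at the re-massed input — the same interaction sum).
  The theorems are stated for a base `B′` with `B′ = { X.toTowerBase … with W := W′ }` as a hypothesis (`subst`), to keep statements short.

HONEST FRAMING: count-neutral helper; no `W′` is exhibited here (files II∕III do, from the a.e. bound); the (α)-AC rows are HYPOTHESES (N08's object gap in AC currency);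
N08 NOT discharged; one finite 𝕋⁴ programme at fixed ε, Bałaban AS PRINTED — R4 closes the conditional finite-𝕋⁴ rung `BalabanLadder.UV` only; the Yang–Mills mass gap
(Clay) is NOT proved by any of this; nothing continuum ∕ ℝ⁴ ∕ OS.  No `sorry`, standard axioms.
-/

noncomputable section

open MeasureTheory

namespace Summit.QuantumFields.YangMills.BalabanUVNodes.N08ReMassedACStepBounds

open Literature.MathematicalPhysics.QuantumFieldTheory.Balaban1983to89
open Literature.MathematicalPhysics.QuantumFieldTheory.Balaban1983to89.AveragingRT (rnTransport rnTransport_nonneg)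
open Literature.MathematicalPhysics.QuantumFieldTheory.Balaban1983to89.B10SectAGathering (StepPieces Bound55 Bound55Lower)
open Literature.MathematicalPhysics.QuantumFieldTheory.Balaban1985CMP102
open Literature.MathematicalPhysics.QuantumFieldTheory.Balaban1985CMP102.Setting
open Summit.QuantumFields.Balaban3D
open Summit.QuantumFields.Balaban3D.Carriers
open Summit.QuantumFields.Balaban3D.Proofs
open Summit.QuantumFields.Balaban3D.Proofs.TowerAC
open Summit.QuantumFields.Balaban3D.Proofs.SeriesAC
open Summit.QuantumFields.Balaban3D.Proofs.StandardAC
open Summit.QuantumFields.Balaban3D.Proofs.InputsAC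
open Summit.QuantumFields.Balaban3D.Proofs.MassesAC
open Summit.QuantumFields.Balaban3D.Proofs.Bound55AC
open Summit.QuantumFields.Balaban3D.Proofs.Bound55Masses (chiB chiB_nonneg chiB_le_one measurable_chiB measurable_stepWeight stepWeight_mul_chiB_cover)
open Summit.QuantumFields.Balaban3D.Proofs.AlphaAC (AlphaDataAC StepAlphaAC)
open Summit.QuantumFields.Balaban3D.Proofs.GroupModelLieC (lieC)
open Summit.QuantumFields.YangMills.BalabanUVNodes.N08SeriesACStepBounds

variable {L : ℕ} {S : Scales L} {G : Type} [GaugeGroup G] [MeasurableSpace G] [HaarData G]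

/-! ## §1 Abstract a.e. transfers -/
section Transfer

variable {k : ℕ} {avg : GaugeField S.P k G → GaugeField S.P (k + 1) G}

/-- **ABSTRACT `hm₁` TRANSFER**: a.e.-equal non-negative masses have the same weighted transport (`Carriers.rnTransport_congr_ae`), so «transport ≤ next mass, a.e.»
passes from `(m, n)` to `(m′, n′)` when `m′ =ᵐ m` and `n =ᵐ n′`. [folklore] -/
theorem transport_weighted_le_ae_congr {w m m' : Density S.P k G} {n n' : Density S.P (k + 1) G}
    (hw0 : ∀ U, 0 ≤ w U) (hm0 : ∀ U, 0 ≤ m U) (hm0' : ∀ U, 0 ≤ m' U)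
    (hmm' : m' =ᵐ[fieldMeasure S.P k G] m) (hnn' : n =ᵐ[fieldMeasure S.P (k + 1) G] n')
    (h : (rnTransport avg fun U => w U * m U) ≤ᵐ[fieldMeasure S.P (k + 1) G] n) :
    (rnTransport avg fun U => w U * m' U) ≤ᵐ[fieldMeasure S.P (k + 1) G] n' := by
  have hc : (rnTransport avg fun U => w U * m' U) = rnTransport avg fun U => w U * m U :=
    rnTransport_congr_ae (hmm'.mono fun U hU => by simp only [hU]) (fun U => mul_nonneg (hw0 U) (hm0' U)) (fun U => mul_nonneg (hw0 U) (hm0 U))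
  rw [hc]
  exact h.trans hnn'.le

/-- **ABSTRACT FIBRE-INEQUALITY TRANSFER**: the transported (49) ≤ (55)·(58) display for masses `m` gives the same display for a.e.-equal non-negative masses `m′`
(both transports see only the `dU`-class). [folklore] -/
theorem fibre_le_ae_congr {w χ m m' : Density S.P k G} (E : Density S.P k G) (E' : Density S.P (k + 1) G)
    (hw0 : ∀ U, 0 ≤ w U) (hχ0 : ∀ U, 0 ≤ χ U) (hm0 : ∀ U, 0 ≤ m U) (hm0' : ∀ U, 0 ≤ m' U) (hmm' : m' =ᵐ[fieldMeasure S.P k G] m)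
    (h : (rnTransport avg fun U => w U * χ U * (m U * Real.exp (E U))) ≤ᵐ[fieldMeasure S.P (k + 1) G]
      fun V => rnTransport avg (fun U => w U * m U) V * Real.exp (E' V)) :
    (rnTransport avg fun U => w U * χ U * (m' U * Real.exp (E U))) ≤ᵐ[fieldMeasure S.P (k + 1) G]
      fun V => rnTransport avg (fun U => w U * m' U) V * Real.exp (E' V) := by
  have c1 : (rnTransport avg fun U => w U * χ U * (m' U * Real.exp (E U))) = rnTransport avg fun U => w U * χ U * (m U * Real.exp (E U)) :=
    rnTransport_congr_ae (hmm'.mono fun U hU => by simp only [hU])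
      (fun U => mul_nonneg (mul_nonneg (hw0 U) (hχ0 U)) (mul_nonneg (hm0' U) (Real.exp_pos _).le))
      (fun U => mul_nonneg (mul_nonneg (hw0 U) (hχ0 U)) (mul_nonneg (hm0 U) (Real.exp_pos _).le))
  have c2 : (rnTransport avg fun U => w U * m' U) = rnTransport avg fun U => w U * m U :=
    rnTransport_congr_ae (hmm'.mono fun U hU => by simp only [hU]) (fun U => mul_nonneg (hw0 U) (hm0' U)) (fun U => mul_nonneg (hw0 U) (hm0 U))
  rw [c1, c2]
  exact h

end Transfer

/-! ## §2 The re-massed standard base: `hm₁`, the fibre displays, integrability, C1 ∕ C2 -/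
section ReMassed

variable {𝔊 : GroupModel G} {𝔠 : Primitives.AlphaConsts L 𝔊.N} {X : ExternalInputsAC S G}
  {𝔖 : ∀ k, StepSeries S G ↥(lieC 𝔊) (nblkOf S 𝔠.lane.carrier k) k} {𝔄 : AlphaDataAC 𝔊 𝔠 X 𝔖}
  (W' : HistWeightsAC S.P G)
  (hae : ∀ j, j ≤ S.K → ∀ h : Hist S.P j, W'.mass j h =ᵐ[fieldMeasure S.P j G]
    massRecAC 𝔠.lane.carrier.M₁ (rcolOf S 𝔠.lane.carrier) (eps1Of S 𝔠.lane.carrier) (epsSOf S 𝔠.lane.carrier) X.av j h)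
  (hle : ∀ (j : ℕ) (h : Hist S.P j) (U : GaugeField S.P j G),
    W'.mass j h U ≤ massRecAC 𝔠.lane.carrier.M₁ (rcolOf S 𝔠.lane.carrier) (eps1Of S 𝔠.lane.carrier) (epsSOf S 𝔠.lane.carrier) X.av j h U)

include hle in
/-- The re-massed masses vanish, pointwise, off admissible histories (they are dominated by print's, which do). [folklore] -/
theorem reMassed_mass_eq_zero_of_not_admissible (j : ℕ) (h : Hist S.P j) (U : GaugeField S.P j G)
    (hh : ¬ Hist.Admissible 𝔠.lane.carrier.M₁ (rcolOf S 𝔠.lane.carrier) j h) : W'.mass j h U = 0 :=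
  le_antisymm ((hle j h U).trans_eq (massRecAC_eq_zero_of_not_admissible _ _ _ _ _ j h U hh)) (W'.mass_nonneg j h U)

include hae in
/-- ★ **`hm₁` FOR THE RE-MASSED BASE**: «transport of the weighted level-`k` mass ≤ the level-`(k+1)` mass, a.e.» for `W′` (`k + 1 ≤ K`), from the lane's
`MassesAC.transport_le_massRecAC_ae` along the a.e. agreement at both levels. [cite: Balaban1985UV3, (48) p.268 (bookkeeping)] -/
theorem transport_le_reMassed_ae {k : ℕ} (hk : k + 1 ≤ S.K) (h' : Hist S.P (k + 1)) :
    (rnTransport (X.av k).avg fun U =>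
        stepWeight 𝔠.lane.carrier.M₁ (rcolOf S 𝔠.lane.carrier) (eps1Of S 𝔠.lane.carrier) (epsSOf S 𝔠.lane.carrier) k h' U * W'.mass k h'.proj U)
      ≤ᵐ[fieldMeasure S.P (k + 1) G] W'.mass (k + 1) h' :=
  transport_weighted_le_ae_congr (stepWeight_nonneg _ _ _ _ k h') (massRecAC_nonneg _ _ _ _ _ k h'.proj) (W'.mass_nonneg k h'.proj)
    (hae k (by omega) h'.proj) (hae (k + 1) hk h').symm (transport_le_massRecAC_ae _ _ _ _ X.av k h')

variable (B' : TowerBaseAC S G) (hB' : B' = { X.toTowerBase 𝔠.lane.carrier with W := W' })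

include hB' in
/-- ★ **THE TRIVIAL-HISTORY FIBRE INEQUALITY R3D-02 FOR THE RE-MASSED BASE** is the std tower's `Fibre57LowAC` (it reads no mass): transported along the normal forms of I-a.
[cite: Balaban1985UV3, p.265 L21–28 + (47) p.267 + p.272 L32–33] -/
theorem fibre57Low_reMassed {k : ℕ} (A : StepAlphaAC 𝔊 𝔠 X 𝔖 𝔄 k) :
    (fun V => ((B'.withSeriesAC 𝔖 (piecesParamsOf S 𝔠.lane.carrier)).towerWith fun _ => True).chi (k + 1) V *
        Real.exp (-(((B'.withSeriesAC 𝔖 (piecesParamsOf S 𝔠.lane.carrier)).towerWith fun _ => True).mainT (k + 1) (Hist.triv S.P (k + 1)) V)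
          - ((B'.withSeriesAC 𝔖 (piecesParamsOf S 𝔠.lane.carrier)).towerWith fun _ => True).Ecst k
          + ((piecesParamsOf S 𝔠.lane.carrier k).logσ₀ + (piecesParamsOf S 𝔠.lane.carrier k).dg * Real.log (S.gk k)) *
              (piecesParamsOf S 𝔠.lane.carrier k).starB (Hist.triv S.P (k + 1))
          + (𝔖 k).logZU (Hist.triv S.P (k + 1)) V + (𝔖 k).Pold B'.M₁ B'.Rcol (Hist.triv S.P (k + 1)) V
          - ((B'.withSeriesAC 𝔖 (piecesParamsOf S 𝔠.lane.carrier)).towerWith fun _ => True).Rm k + (𝔖 k).logFl (Hist.triv S.P (k + 1)) V))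
      ≤ᵐ[fieldMeasure S.P (k + 1) G] rnTransport (B'.av k).avg (fun U =>
        ((B'.withSeriesAC 𝔖 (piecesParamsOf S 𝔠.lane.carrier)).towerWith fun _ => True).chi k U *
        Real.exp (-(((B'.withSeriesAC 𝔖 (piecesParamsOf S 𝔠.lane.carrier)).towerWith fun _ => True).mainT k (Hist.triv S.P k) U)
          + (B'.withSeriesAC 𝔖 (piecesParamsOf S 𝔠.lane.carrier)).Pint k (Hist.triv S.P k) U
          - ((B'.withSeriesAC 𝔖 (piecesParamsOf S 𝔠.lane.carrier)).towerWith fun _ => True).Ecst k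
          - ((B'.withSeriesAC 𝔖 (piecesParamsOf S 𝔠.lane.carrier)).towerWith fun _ => True).Rm k)) := by
  subst hB'
  have hf := A.fibre57Low
  unfold Fibre57LowAC at hf
  dsimp only [stdTowerInputAC, towerInputOfAC] at hf
  simp only [towerWith_chi, towerWith_mainT, towerWith_Ecst, towerWith_Rm, withSeriesAC_Pint] at hf ⊢
  dsimp only [piecesWAC, piecesAC, TowerBaseAC.seriesPiecesAC, TowerInputAC.pieces3, ExternalInputsAC.toTowerBase, piecesParamsOf,
    StepSeries.toStepData] at hf ⊢
  exact hf

include hB' hae in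
/-- ★★ **THE FIBRE INEQUALITY R3D-01 FOR THE RE-MASSED BASE** from the std tower's `Fibre49AC` (a.e. hypothesis of `StepAlphaAC`): normal forms of I-a + the abstract transfer
`fibre_le_ae_congr` along `W′_k =ᵐ m_k` (`k ≤ K`). [cite: Balaban1985UV3, (49)–(58) pp.268–270 (bookkeeping)] -/
theorem fibre49_reMassed {k : ℕ} (hk : k ≤ S.K) (A : StepAlphaAC 𝔊 𝔠 X 𝔖 𝔄 k) (h' : Hist S.P (k + 1)) :
    (rnTransport (B'.av k).avg (fun U =>
        stepWeight B'.M₁ B'.Rcol (eps1Of S 𝔠.lane.carrier) (epsSOf S 𝔠.lane.carrier) k h' U * chiB B'.M₁ B'.Rcol (eps1Of S 𝔠.lane.carrier) k h' U *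
        (B'.W.mass k h'.proj U *
          Real.exp (-(((B'.withSeriesAC 𝔖 (piecesParamsOf S 𝔠.lane.carrier)).towerWith fun _ => True).mainT k h'.proj U)
            + (B'.withSeriesAC 𝔖 (piecesParamsOf S 𝔠.lane.carrier)).Pint k h'.proj U
            - ((B'.withSeriesAC 𝔖 (piecesParamsOf S 𝔠.lane.carrier)).towerWith fun _ => True).Ecst k
            + ((B'.withSeriesAC 𝔖 (piecesParamsOf S 𝔠.lane.carrier)).towerWith fun _ => True).Zterm k h'.proj
            + ((B'.withSeriesAC 𝔖 (piecesParamsOf S 𝔠.lane.carrier)).towerWith fun _ => True).Rm k))))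
      ≤ᵐ[fieldMeasure S.P (k + 1) G] fun V => rnTransport (B'.av k).avg (fun U =>
        stepWeight B'.M₁ B'.Rcol (eps1Of S 𝔠.lane.carrier) (epsSOf S 𝔠.lane.carrier) k h' U * B'.W.mass k h'.proj U) V *
        Real.exp (-(((B'.withSeriesAC 𝔖 (piecesParamsOf S 𝔠.lane.carrier)).towerWith fun _ => True).mainT (k + 1) h' V)
          - ((B'.withSeriesAC 𝔖 (piecesParamsOf S 𝔠.lane.carrier)).towerWith fun _ => True).Ecst k
          + ((piecesParamsOf S 𝔠.lane.carrier k).logσ₀ + (piecesParamsOf S 𝔠.lane.carrier k).dg * Real.log (S.gk k)) *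
              (piecesParamsOf S 𝔠.lane.carrier k).starB h'
          + (𝔖 k).logZU h' V + (𝔖 k).Pold B'.M₁ B'.Rcol h' V
          + ((B'.withSeriesAC 𝔖 (piecesParamsOf S 𝔠.lane.carrier)).towerWith fun _ => True).Zterm k (Hist.proj h')
          + ((B'.withSeriesAC 𝔖 (piecesParamsOf S 𝔠.lane.carrier)).towerWith fun _ => True).Rm k
          + (𝔖 k).logFl h' V) := by
  subst hB'
  have hf := A.fibre49 h'
  unfold Fibre49AC at hf
  dsimp only [stdTowerInputAC, towerInputOfAC] at hf
  simp only [towerWith_mainT, towerWith_Ecst, towerWith_Rm, towerWith_Zterm, withSeriesAC_Pint] at hf ⊢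
  dsimp only [piecesWAC, piecesAC, TowerBaseAC.seriesPiecesAC, TowerInputAC.pieces3, ExternalInputsAC.toTowerBase, piecesParamsOf,
    StepSeries.toStepData, histWeightsAC] at hf ⊢
  exact fibre_le_ae_congr _ _ (stepWeight_nonneg _ _ _ _ k h') (chiB_nonneg _ _ _ k h') (massRecAC_nonneg _ _ _ _ _ k h'.proj)
    (W'.mass_nonneg k h'.proj) (hae k hk h'.proj) hf

variable (hWm : ∀ (j : ℕ) (h : Hist S.P j), Measurable (W'.mass j h)) (hmt : ∀ (j : ℕ) (U : GaugeField S.P j G), 1 ≤ W'.mass j (Hist.triv S.P j) U)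

include hle hWm in
/-- The re-massed masses are integrable (dominated by print's integrable masses `MassesAC.integrable_massRecAC`). [folklore] -/
theorem integrable_reMassed [RegularGaugeGroup G] (j : ℕ) (h : Hist S.P j) : Integrable (W'.mass j h) (fieldMeasure S.P j G) :=
  (integrable_massRecAC _ _ _ _ X.av j h).mono' (hWm j h).aestronglyMeasurable
    (Filter.Eventually.of_forall fun U => by
      rw [Real.norm_eq_abs, abs_of_nonneg (W'.mass_nonneg j h U)]; exact hle j h U)

include hB' hae hle hWm hmt in
/-- ★★★ **C1 `Bound55` FOR THE RE-MASSED BASE `{ X.toTowerBase 𝔠.lane.carrier with W := W′ }` FROM THE (α)-AC STEP INPUT** (`k + 1 ≤ K`): I-a's generic step with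
`hm₁` from `transport_le_reMassed_ae`, the fibre inequality from `fibre49_reMassed`, integrability from `hint_seriesAC` (rows `hU`, `hPm`, `hPb` of `StepAlphaAC` read at the
re-massed input — the same interaction sum), thresholds `ε_L(k) ≤ ε_S(k)` (`AlphaBound55.eps1Of_le_epsSOf`), the floor `hmt`, `Rm ≥ 0` (`rcoefOf ≥ 0`).
[cite: Balaban1985UV3, (22) p.261 + (48)–(49) pp.267–268 + (55) p.269 + (58) p.270] -/
theorem bound55_reMassed {k : ℕ} (hk : k + 1 ≤ S.K) (A : StepAlphaAC 𝔊 𝔠 X 𝔖 𝔄 k) :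
    Bound55 (B'.seriesPiecesAC 𝔖 (piecesParamsOf S 𝔠.lane.carrier) k) := by
  haveI : RegularGaugeGroup G := Carriers.groupModel_regularGaugeGroup 𝔊
  have hfib := fibre49_reMassed W' hae B' hB' (by omega) A
  subst hB'
  refine bound55_seriesPiecesAC _ 𝔖 (piecesParamsOf S 𝔠.lane.carrier) (eps1Of S 𝔠.lane.carrier) (epsSOf S 𝔠.lane.carrier) k
    (AlphaBound55.eps1Of_le_epsSOf k 𝔠.lane.carrier 𝔠.lane.F.b₀_nonneg 𝔠.lane.F.p₀_pos.le (by omega))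
    (fun h' => transport_le_reMassed_ae W' hae hk h')
    (fun h U hh => reMassed_mass_eq_zero_of_not_admissible W' hle k h U hh)
    (fun V => hmt (k + 1) V)
    (rm_nonneg_seriesAC _ 𝔖 _ k fun j => ?_)
    (hint_seriesAC _ 𝔖 _ k (fun h => A.hU h) (fun h => A.hPm h) (𝔄.cP k) (fun h U => A.hPb h U)
      (fun h => integrable_reMassed W' hle hWm k h))
    hfib
  -- `rcoefOf ≥ 0`
  show 0 ≤ 𝔠.lane.sc.rstar * S.g ^ ((6 : ℝ) + 2 * 𝔠.lane.F.κ₀)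
  exact mul_nonneg 𝔠.lane.sc.rstar_nonneg (Real.rpow_nonneg S.g_pos.le _)

include hB' in
/-- ★★★ **C2 `Bound55Lower` FOR THE RE-MASSED BASE FROM THE (α)-AC STEP INPUT**: I-a's generic lower step with the trivial-history fibre inequality from `fibre57Low_reMassed`
and `hint47_seriesAC`. [cite: Balaban1985UV3, p.265 L21–28 + (47) p.267 + p.272 L32–33] -/
theorem bound55Lower_reMassed {k : ℕ} (A : StepAlphaAC 𝔊 𝔠 X 𝔖 𝔄 k) :
    Bound55Lower (B'.seriesPiecesAC 𝔖 (piecesParamsOf S 𝔠.lane.carrier) k) := by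
  haveI : RegularGaugeGroup G := Carriers.groupModel_regularGaugeGroup 𝔊
  have hfl := fibre57Low_reMassed W' B' hB' A
  subst hB'
  exact bound55Lower_seriesPiecesAC _ 𝔖 (piecesParamsOf S 𝔠.lane.carrier) k
    (hint47_seriesAC _ 𝔖 _ k (A.hU _) (A.hPm _) (𝔄.cP k) (fun U => A.hPb _ U)) hfl

end ReMassed

end Summit.QuantumFields.YangMills.BalabanUVNodes.N08ReMassedACStepBounds

end
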